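/-
VALUE = THEOREM, NOT summit progress (cell b2b-lgcu-borel, gen 25); crux 14079 untouched.
-/
import Mathlib
import Summits.MatrixMultiplication.MatrixMultiplication.Theorems.SubgroupIdentityDesigns.Negative.CuspidalObstructionPlacements
import Summits.MatrixMultiplication.MatrixMultiplication.Theorems.SubgroupIdentityDesigns.Negative.DesignConjGL
import Summits.MatrixMultiplication.MatrixMultiplication.Theorems.SubgroupIdentityDesigns.Negative.TransvectionSylow

/-!
# Opposite root pairs generate `SL₂(𝔽_p) ⊕ 1`: no member of a level-one witness in `GL₃(𝔽_p)`
# contains a transvection unless all its Sylow `p`-subgroups are normal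

VALUE = THEOREM (structure law on HYPOTHETICAL level-one witnesses of the crux
`SubgroupIdentityDesigns`, `m = 3`, `k = 1`), NOT summit progress.  The crux item is neither
restated nor weakened; this file is a `--supports` helper under `Negative/`.

THEOREM A (`no_design_of_opposite_pair`, every odd `p`, every `ε`, no TPP).  If a member `H` of
a triple `(H₁, H₂, H₃)` of subgroups of `GL₃(𝔽_p)` contains two root elements
`t = 1 + c ⊗ φ`, `t' = 1 + c' ⊗ φ'` (`φ(c) = φ'(c') = 0`) forming an OPPOSITE PAIR
(`φ(c') ≠ 0`, `φ'(c) ≠ 0`), the triple carries no level-one identity design.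
PROOF.  In the frame `F = (c | c' | d)`, `d = φ × φ'` (a non-zero common kernel vector), `t` and
`t'` become the elementary matrices `u_{φ(c')} ⊕ 1` and `u⁻_{φ'(c)} ⊕ 1`; their powers give all
`u_y ⊕ 1`, `u⁻_z ⊕ 1`, and `s = u_{(a-1)/γ} u⁻_γ u_{(δ-1)/γ}` (`γ = s₁₀ ≠ 0`), `s = u⁻_{-1}(u⁻_1 s)`
(`s₁₀ = 0`) exhaust `SL₂(𝔽_p)`.  So `F (SL₂(𝔽_p) ⊕ 1) F⁻¹ ≤ H`; conjugating the design by `F⁻¹`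
(`DesignConjGL.design_conj`) contradicts `CuspidalObstruction.no_design_memᵢ_all`.

THEOREM B (`transvection_member_sylow_normal`, `p ≥ 3`, `−2 < ε ≤ 1`).  In a subgroup-TPP triple
of `GL₃(𝔽_p)` with a level-one identity design and the crux inequality, every member containing
a transvection has ALL ITS SYLOW `p`-SUBGROUPS NORMAL (hence is reducible and lies in `N(P)`,
`NormalSylowLaw`): the other branch of `TransvectionSylow.crux_transvection_dichotomy` is an
opposite pair, excluded by Theorem A.

CONSEQUENCE for the `m = 3` trichotomy of the cell (ORACLE-g25): case (S) (`|H|_p = p`, at least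
`p + 1` Sylow subgroups) contains no transvection — its `p`-elements are regular unipotents.

HONEST SCOPE.  Structure law; it empties no `(p, m, ε)` cell.  Sorry-free; standard axioms.
-/

set_option linter.dupNamespace false

noncomputable section

open scoped BigOperators Classical Matrix

namespace Summit.MatrixMultiplication.MatrixMultiplication.Theorems.SubgroupIdentityDesigns.Negative
namespace OppositeRootPairs

open Summit.MatrixMultiplication.MatrixMultiplication.Theorems.LieRankDesigns.Negative (GLm Mat budget)
open Literature.Barriers.MatrixMultiplication (SubgroupTPP)
open Matrix (vecMulVec)
open SummandTransport (emb embMat)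
open CuspidalObstruction (SL2 ux lx coe_ux coe_lx)

variable {p : ℕ} [hp : Fact p.Prime]

/-! ## 1. `u_y` and `u⁻_z` generate `SL₂(𝔽_p)` -/

section Gen

/-- `u_{(a-1)/γ} · u⁻_γ · u_{(δ-1)/γ} = s` for `s = [[a, b], [γ, δ]] ∈ SL₂` with `γ ≠ 0`. -/
theorem ux_lx_ux_eq (s : SL2 p) (hγ : (s : Mat p 2) 1 0 ≠ 0) :
    ux (((s : Mat p 2) 0 0 - 1) * ((s : Mat p 2) 1 0)⁻¹) * lx ((s : Mat p 2) 1 0) *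
      ux (((s : Mat p 2) 1 1 - 1) * ((s : Mat p 2) 1 0)⁻¹) = s := by
  have hdet : (s : Mat p 2) 0 0 * (s : Mat p 2) 1 1 - (s : Mat p 2) 0 1 * (s : Mat p 2) 1 0 = 1 := by
    have h := s.det_coe
    rwa [Matrix.det_fin_two] at h
  ext i j
  fin_cases i <;> fin_cases j <;>
    simp [Matrix.SpecialLinearGroup.coe_mul, coe_ux, coe_lx, Matrix.mul_apply, Fin.sum_univ_two]
  · field_simp
    ring
  · field_simp
    linear_combination hdet
  · field_simp
    ring

/-- `u⁻_{-1} · u⁻_1 = 1`. -/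
theorem lx_neg_one_mul_lx_one : (lx (-1) : SL2 p) * lx 1 = 1 := by
  ext i j
  fin_cases i <;> fin_cases j <;>
    simp [Matrix.SpecialLinearGroup.coe_mul, coe_lx, Matrix.mul_apply, Fin.sum_univ_two]

/-- **`SL₂(𝔽_p) = ⟨u_y, u⁻_z⟩`**: a subgroup containing all `u_y` and all `u⁻_z` is everything. -/
theorem mem_of_root_elements (K : Subgroup (SL2 p)) (hu : ∀ y, ux y ∈ K) (hl : ∀ z, lx z ∈ K)
    (s : SL2 p) : s ∈ K := by
  by_cases hγ : (s : Mat p 2) 1 0 ≠ 0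
  · rw [← ux_lx_ux_eq s hγ]
    exact K.mul_mem (K.mul_mem (hu _) (hl _)) (hu _)
  · push Not at hγ
    have hdet : (s : Mat p 2) 0 0 * (s : Mat p 2) 1 1 - (s : Mat p 2) 0 1 * (s : Mat p 2) 1 0 = 1 := by
      have h := s.det_coe
      rwa [Matrix.det_fin_two] at h
    have ha : (s : Mat p 2) 0 0 ≠ 0 := by
      intro h0; rw [h0, hγ] at hdet; simp at hdet
    set s' : SL2 p := lx 1 * s with hs'
    have hγ' : (s' : Mat p 2) 1 0 ≠ 0 := by
      rw [hs', Matrix.SpecialLinearGroup.coe_mul, coe_lx]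
      simp [Matrix.mul_apply, Fin.sum_univ_two, hγ, ha]
    have hs : s = lx (-1) * s' := by
      rw [hs', ← mul_assoc, lx_neg_one_mul_lx_one, one_mul]
    rw [hs, ← ux_lx_ux_eq s' hγ']
    exact K.mul_mem (hl _) (K.mul_mem (K.mul_mem (hu _) (hl _)) (hu _))

end Gen

/-! ## 2. The coordinates `(0, 1 | 2)` of `𝔽_p³` and the block-embedded root elements -/

section Emb

/-- The coordinate splitting `Fin 2 ⊕ Fin 1 ≃ Fin 3` (block on the coordinates `0, 1`). -/
def e₃ : Fin 2 ⊕ Fin 1 ≃ Fin 3 := finSumFinEquiv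

/-- `e₃ (inl 0) = 0`. -/
@[simp] theorem e₃_inl_zero : e₃ (Sum.inl 0) = 0 := rfl
/-- `e₃ (inl 1) = 1`. -/
@[simp] theorem e₃_inl_one : e₃ (Sum.inl 1) = 1 := rfl
/-- `e₃ (inr 0) = 2`. -/
@[simp] theorem e₃_inr_zero : e₃ (Sum.inr 0) = 2 := rfl

/-- Matrices of `Mat₃` are determined by their entries in the `e₃`-coordinates. -/
theorem embMat_eq_of {N : Mat p 2} {M' : Mat p 3}
    (h : ∀ x y, Matrix.fromBlocks N 0 0 (1 : Mat p 1) x y = M' (e₃ x) (e₃ y)) :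
    embMat e₃ N = M' := by
  ext i j
  obtain ⟨x, rfl⟩ := e₃.surjective i
  obtain ⟨y, rfl⟩ := e₃.surjective j
  rw [SummandTransport.embMat_apply]
  exact h x y

/-- `u_y ⊕ 1 = 1 + y · e₀ ⊗ e₁`. -/
theorem embMat_ux (y : ZMod p) : embMat e₃ ((ux y : SL2 p) : Mat p 2) =
    1 + y • vecMulVec (Pi.single 0 1) (Pi.single 1 1) := by
  refine embMat_eq_of fun x z => ?_
  rcases x with x | x <;> rcases z with z | z <;> fin_cases x <;> fin_cases z <;>
    simp [coe_ux, Matrix.vecMulVec_apply]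

/-- `u⁻_z ⊕ 1 = 1 + z · e₁ ⊗ e₀`. -/
theorem embMat_lx (y : ZMod p) : embMat e₃ ((lx y : SL2 p) : Mat p 2) =
    1 + y • vecMulVec (Pi.single 1 1) (Pi.single 0 1) := by
  refine embMat_eq_of fun x z => ?_
  rcases x with x | x <;> rcases z with z | z <;> fin_cases x <;> fin_cases z <;>
    simp [coe_lx, Matrix.vecMulVec_apply]

end Emb

/-! ## 3. The frame `F = (c | c' | d)` of an opposite pair -/

section Frame

variable (c c' d : Fin 3 → ZMod p)

/-- The matrix with columns `c, c', d`. -/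
def frame : Mat p 3 := Matrix.of fun i j => ![c, c', d] j i

omit hp in
/-- The `j`-th column of `frame c c' d` is `c`, `c'`, `d` respectively. -/
theorem frame_col (j : Fin 3) : (frame c c' d).col j = ![c, c', d] j := rfl

/-- A covector times the frame lists its values on the columns: `ψ F = (ψ(c), ψ(c'), ψ(d))`. -/
theorem vecMul_frame (ψ : Fin 3 → ZMod p) :
    ψ ᵥ* frame c c' d = ![ψ ⬝ᵥ c, ψ ⬝ᵥ c', ψ ⬝ᵥ d] := by
  funext j
  fin_cases j <;> rfl

variable {c c' d}

/-- The frame is invertible when `φ(c) = 0 ≠ φ(c')`, `φ'(c') = 0 ≠ φ'(c)`, `φ(d) = φ'(d) = 0 ≠ d`. -/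
theorem isUnit_frame {φ φ' : Fin 3 → ZMod p} (hφc : φ ⬝ᵥ c = 0) (hφ'c' : φ' ⬝ᵥ c' = 0)
    (hl : φ ⬝ᵥ c' ≠ 0) (hm : φ' ⬝ᵥ c ≠ 0) (hφd : φ ⬝ᵥ d = 0) (hφ'd : φ' ⬝ᵥ d = 0) (hd : d ≠ 0) :
    IsUnit (frame c c' d) := by
  rw [← Matrix.linearIndependent_cols_iff_isUnit]
  show LinearIndependent (ZMod p) ![c, c', d]
  refine Fintype.linearIndependent_iff.mpr fun g hg => ?_
  rw [Fin.sum_univ_three] at hg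
  simp only [Matrix.cons_val_zero, Matrix.cons_val_one, Matrix.cons_val_two, Matrix.head_cons,
    Matrix.tail_cons] at hg
  have h1 : g 1 = 0 := by
    have h := congrArg (fun v => φ ⬝ᵥ v) hg
    simp only [dotProduct_add, dotProduct_smul, hφc, hφd, smul_eq_mul, mul_zero, add_zero,
      zero_add, dotProduct_zero, mul_eq_zero] at h
    exact h.resolve_right hl
  have h0 : g 0 = 0 := by
    have h := congrArg (fun v => φ' ⬝ᵥ v) hg
    simp only [dotProduct_add, dotProduct_smul, hφ'c', hφ'd, smul_eq_mul, mul_zero, add_zero,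
      dotProduct_zero, mul_eq_zero] at h
    exact h.resolve_right hm
  have h2 : g 2 = 0 := by
    rw [h0, h1, zero_smul, zero_smul, zero_add, zero_add, smul_eq_zero] at hg
    exact hg.resolve_right hd
  intro i
  fin_cases i
  · exact h0
  · exact h1
  · exact h2

/-- `(1 + a · c ⊗ φ) F = F + (a φ(c')) · c ⊗ e₁` when `φ(c) = φ(d) = 0`. -/
theorem root_mul_frame {φ : Fin 3 → ZMod p} (hφc : φ ⬝ᵥ c = 0) (hφd : φ ⬝ᵥ d = 0) (a : ZMod p) :
    (1 + a • vecMulVec c φ) * frame c c' d =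
      frame c c' d + (a * (φ ⬝ᵥ c')) • vecMulVec c (Pi.single 1 1) := by
  have hv : (![φ ⬝ᵥ c, φ ⬝ᵥ c', φ ⬝ᵥ d] : Fin 3 → ZMod p) = (φ ⬝ᵥ c') • Pi.single 1 1 := by
    funext j
    fin_cases j <;> simp [hφc, hφd]
  rw [add_mul, one_mul, Matrix.smul_mul, Matrix.vecMulVec_mul, vecMul_frame, hv,
    Matrix.vecMulVec_smul, smul_smul]

/-- `(1 + b · c' ⊗ φ') F = F + (b φ'(c)) · c' ⊗ e₀` when `φ'(c') = φ'(d) = 0`. -/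
theorem root'_mul_frame {φ' : Fin 3 → ZMod p} (hφ'c' : φ' ⬝ᵥ c' = 0) (hφ'd : φ' ⬝ᵥ d = 0)
    (b : ZMod p) :
    (1 + b • vecMulVec c' φ') * frame c c' d =
      frame c c' d + (b * (φ' ⬝ᵥ c)) • vecMulVec c' (Pi.single 0 1) := by
  have hv : (![φ' ⬝ᵥ c, φ' ⬝ᵥ c', φ' ⬝ᵥ d] : Fin 3 → ZMod p) = (φ' ⬝ᵥ c) • Pi.single 0 1 := by
    funext j
    fin_cases j <;> simp [hφ'c', hφ'd]
  rw [add_mul, one_mul, Matrix.smul_mul, Matrix.vecMulVec_mul, vecMul_frame, hv,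
    Matrix.vecMulVec_smul, smul_smul]

/-- `F (u_y ⊕ 1) = F + y · c ⊗ e₁`. -/
theorem frame_mul_ux (y : ZMod p) :
    frame c c' d * (1 + y • vecMulVec (Pi.single 0 1) (Pi.single 1 1)) =
      frame c c' d + y • vecMulVec c (Pi.single 1 1) := by
  rw [mul_add, mul_one, Matrix.mul_smul, Matrix.mul_vecMulVec, Matrix.mulVec_single_one, frame_col]
  rfl

/-- `F (u⁻_z ⊕ 1) = F + z · c' ⊗ e₀`. -/
theorem frame_mul_lx (z : ZMod p) :
    frame c c' d * (1 + z • vecMulVec (Pi.single 1 1) (Pi.single 0 1)) =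
      frame c c' d + z • vecMulVec c' (Pi.single 0 1) := by
  rw [mul_add, mul_one, Matrix.mul_smul, Matrix.mul_vecMulVec, Matrix.mulVec_single_one, frame_col]
  rfl

end Frame

/-! ## 4. An opposite pair in `H` puts a conjugate of `SL₂(𝔽_p) ⊕ 1` inside `H` -/

section Block

variable {H : Subgroup (GLm p 3)}

/-- A root element of `H` yields, after conjugation by the frame, every `u_y ⊕ 1` (resp.
`u⁻_z ⊕ 1`): the general matrix identity `x E x⁻¹ = t ^ k` behind both. -/
theorem conj_mem_of_eq {x E t : GLm p 3} (htH : t ∈ H) (k : ℕ)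
    (h : (x : Mat p 3) * (E : Mat p 3) = ((t ^ k : GLm p 3) : Mat p 3) * (x : Mat p 3)) :
    x * E * x⁻¹ ∈ H := by
  have hxe : x * E = t ^ k * x := Units.ext (by rw [Units.val_mul, Units.val_mul, h])
  rw [hxe, mul_inv_cancel_right]
  exact H.pow_mem htH k

/-- **OPPOSITE PAIR ⇒ BLOCK.**  If `H ∋ t = 1 + c ⊗ φ`, `t' = 1 + c' ⊗ φ'` with
`φ(c) = φ'(c') = 0`, `φ(c') ≠ 0`, `φ'(c) ≠ 0`, then `x (SL₂(𝔽_p) ⊕ 1) x⁻¹ ≤ H` for some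
`x ∈ GL₃(𝔽_p)`. -/
theorem exists_conj_block {t t' : GLm p 3} (htH : t ∈ H) (ht'H : t' ∈ H)
    {c φ c' φ' : Fin 3 → ZMod p} (ht : (t : Mat p 3) = 1 + vecMulVec c φ)
    (ht' : (t' : Mat p 3) = 1 + vecMulVec c' φ') (hφc : φ ⬝ᵥ c = 0) (hφ'c' : φ' ⬝ᵥ c' = 0)
    (hl : φ ⬝ᵥ c' ≠ 0) (hm : φ' ⬝ᵥ c ≠ 0) :
    ∃ x : GLm p 3, ∀ s : SL2 p, x * emb e₃ (Matrix.SpecialLinearGroup.toGL s) * x⁻¹ ∈ H := by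
  -- the common kernel vector `d = φ × φ'`
  set d : Fin 3 → ZMod p := φ ⨯₃ φ' with hd
  have hφd : φ ⬝ᵥ d = 0 := dot_self_cross φ φ'
  have hφ'd : φ' ⬝ᵥ d = 0 := dot_cross_self φ φ'
  have hd0 : d ≠ 0 := by
    refine crossProduct_ne_zero_iff_linearIndependent.mpr (LinearIndependent.pair_iff.mpr ?_)
    intro a b hab
    have h1 := congrArg (fun ψ => ψ ⬝ᵥ c) hab
    have h2 := congrArg (fun ψ => ψ ⬝ᵥ c') hab
    simp only [add_dotProduct, smul_dotProduct, hφc, hφ'c', smul_eq_mul, mul_zero, zero_add,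
      add_zero, zero_dotProduct, mul_eq_zero] at h1 h2
    exact ⟨h2.resolve_right hl, h1.resolve_right hm⟩
  have hF : IsUnit (frame c c' d) := isUnit_frame hφc hφ'c' hl hm hφd hφ'd hd0
  set x : GLm p 3 := hF.unit with hx
  have hxF : (x : Mat p 3) = frame c c' d := hF.unit_spec
  have hnn : vecMulVec c φ * vecMulVec c φ = 0 := by
    rw [RootElements.vmv_mul_vmv, hφc, zero_smul]
  have hnn' : vecMulVec c' φ' * vecMulVec c' φ' = 0 := by
    rw [RootElements.vmv_mul_vmv, hφ'c', zero_smul]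
  refine ⟨x, ?_⟩
  -- the subgroup of `SL₂` whose block conjugate lies in `H`
  let f : SL2 p →* GLm p 3 := (emb e₃).comp Matrix.SpecialLinearGroup.toGL
  let K : Subgroup (SL2 p) := (H.comap (MulAut.conj x).toMonoidHom).comap f
  have hK : ∀ s : SL2 p, s ∈ K ↔ x * emb e₃ (Matrix.SpecialLinearGroup.toGL s) * x⁻¹ ∈ H := by
    intro s
    simp only [K, f, Subgroup.mem_comap, MonoidHom.coe_comp, Function.comp_apply,
      MulEquiv.coe_toMonoidHom, MulAut.conj_apply]
  have hu : ∀ y, ux y ∈ K := by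
    intro y
    rw [hK]
    set a : ZMod p := y * (φ ⬝ᵥ c')⁻¹ with ha
    refine conj_mem_of_eq htH a.val ?_
    rw [SummandTransport.coe_emb, Matrix.SpecialLinearGroup.coe_GL_coe_matrix, embMat_ux, hxF,
      frame_mul_ux, RootElements.coe_pow_of_sq_zero ht hnn, ZMod.natCast_zmod_val,
      root_mul_frame hφc hφd, ha, inv_mul_cancel_right₀ hl]
  have hlK : ∀ z, lx z ∈ K := by
    intro z
    rw [hK]
    set b : ZMod p := z * (φ' ⬝ᵥ c)⁻¹ with hb
    refine conj_mem_of_eq ht'H b.val ?_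
    rw [SummandTransport.coe_emb, Matrix.SpecialLinearGroup.coe_GL_coe_matrix, embMat_lx, hxF,
      frame_mul_lx, RootElements.coe_pow_of_sq_zero ht' hnn', ZMod.natCast_zmod_val,
      root'_mul_frame hφ'c' hφ'd, hb, inv_mul_cancel_right₀ hm]
  intro s
  exact (hK s).mp (mem_of_root_elements K hu hlK s)

end Block

/-! ## 5. No design with an opposite pair; transvection members have normal Sylow subgroups -/

section Main

variable {H₁ H₂ H₃ : Subgroup (GLm p 3)}

/-- **THEOREM A.**  No member of a triple of `GL₃(𝔽_p)` (`p` odd) with a level-one identity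
design contains an opposite pair of root elements. -/
theorem no_design_of_opposite_pair (hp2 : p ≠ 2) (H : Subgroup (GLm p 3))
    (hH : H = H₁ ∨ H = H₂ ∨ H = H₃) {t t' : GLm p 3} (htH : t ∈ H) (ht'H : t' ∈ H)
    {c φ c' φ' : Fin 3 → ZMod p} (ht : (t : Mat p 3) = 1 + vecMulVec c φ)
    (ht' : (t' : Mat p 3) = 1 + vecMulVec c' φ') (hφc : φ ⬝ᵥ c = 0) (hφ'c' : φ' ⬝ᵥ c' = 0)
    (hl : φ ⬝ᵥ c' ≠ 0) (hm : φ' ⬝ᵥ c ≠ 0) :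
    ¬ ∃ cf : Mat p 3 → ℂ, (∀ M, 1 < M.rank → cf M = 0) ∧
      (∑ M, cf M * ZMod.stdAddChar (Matrix.trace (M * ((1 : GLm p 3) : Mat p 3)))) = 1 ∧
      ∀ a ∈ H₁, ∀ b ∈ H₂, ∀ g ∈ H₃, a * b * g ≠ 1 →
        (∑ M, cf M * ZMod.stdAddChar (Matrix.trace (M * ((a * b * g : GLm p 3) : Mat p 3)))) = 0 := by
  intro hdes
  obtain ⟨x, hx⟩ := exists_conj_block htH ht'H ht ht' hφc hφ'c' hl hm
  have hdes' := DesignConjGL.design_conj 1 H₁ H₂ H₃ x⁻¹ hdes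
  have hmem : ∀ s : SL2 p,
      emb e₃ (Matrix.SpecialLinearGroup.toGL s) ∈ H.map (MulAut.conj x⁻¹).toMonoidHom := by
    intro s
    refine Subgroup.mem_map.mpr ⟨x * emb e₃ (Matrix.SpecialLinearGroup.toGL s) * x⁻¹, hx s, ?_⟩
    rw [MulEquiv.coe_toMonoidHom, MulAut.conj_apply, inv_inv]
    group
  rcases hH with rfl | rfl | rfl
  · exact CuspidalObstruction.no_design_mem₁_all e₃ hp2 hmem hdes'
  · exact CuspidalObstruction.no_design_mem₂_all e₃ hp2 hmem hdes'
  · exact CuspidalObstruction.no_design_mem₃_all e₃ hp2 hmem hdes'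

/-- **THEOREM B (TRANSVECTION ⇒ NORMAL SYLOW, `m = 3`).**  In a subgroup-TPP triple of
`GL₃(𝔽_p)` (`p ≥ 3`) with a level-one identity design and the crux inequality (`−2 < ε ≤ 1`),
every Sylow `p`-subgroup of a member containing a transvection `1 + c ⊗ φ` is normal. -/
theorem transvection_member_sylow_normal (hp3 : 3 ≤ p) {ε : ℝ} (hε : -2 < ε) (hε1 : ε ≤ 1)
    (htpp : SubgroupTPP H₁ H₂ H₃)
    (hdes : ∃ cf : Mat p 3 → ℂ, (∀ M, 1 < M.rank → cf M = 0) ∧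
      (∑ M, cf M * ZMod.stdAddChar (Matrix.trace (M * ((1 : GLm p 3) : Mat p 3)))) = 1 ∧
      ∀ a ∈ H₁, ∀ b ∈ H₂, ∀ g ∈ H₃, a * b * g ≠ 1 →
        (∑ M, cf M * ZMod.stdAddChar (Matrix.trace (M * ((a * b * g : GLm p 3) : Mat p 3)))) = 0)
    (hlt : budget p 3 1 (2 + ε) < ((Nat.card H₁ * Nat.card H₂ * Nat.card H₃ : ℕ) : ℝ) ^ ((2 + ε) / 3))
    (H : Subgroup (GLm p 3)) (hH : H = H₁ ∨ H = H₂ ∨ H = H₃)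
    {t : GLm p 3} (htH : t ∈ H) {c φ : Fin 3 → ZMod p} (ht : (t : Mat p 3) = 1 + vecMulVec c φ)
    (hc : c ≠ 0) (hφ : φ ≠ 0) (hφc : φ ⬝ᵥ c = 0) :
    ∀ P : Sylow p H, (P : Subgroup H).Normal := by
  have hp2 : p ≠ 2 := by omega
  rcases TransvectionSylow.crux_transvection_dichotomy hp3 hε hε1 htpp hdes hlt H hH htH ht hc hφ
    hφc with hN | ⟨k, hkH, hk1, hk2⟩
  · exact hN
  · exfalso
    have hk : ((k * t * k⁻¹ : GLm p 3) : Mat p 3) =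
        1 + vecMulVec ((k : Mat p 3) *ᵥ c) (φ ᵥ* ((k⁻¹ : GLm p 3) : Mat p 3)) :=
      RootElements.coe_conj t k ht
    exact no_design_of_opposite_pair hp2 H hH htH (H.mul_mem (H.mul_mem hkH htH) (H.inv_mem hkH))
      ht hk hφc ((RootElements.conj_dot k c φ).trans hφc) hk1 hk2 hdes

end Main

end OppositeRootPairs
end Summit.MatrixMultiplication.MatrixMultiplication.Theorems.SubgroupIdentityDesigns.Negative
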